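import Summits.NavierStokesRegularity.NavierStokesRegularity.Theorems.GaldiLiouvilleGateRecordZoomAncientOfKernel
import HarnessLib

/-!
# Route `GaldiLiouvilleGate`, crux `RecordZoomAncient` (stmt-NavierStokesRegularity-0894),
  line `registered` (birth skeleton, reshape r7) — stub `stub_kernelAt`
  (the r5/r6 composition of the line, made POINTWISE in the solution)

**Statement.** Fix `ν, T > 0` and a classical solution `(u, p)` of the unforced Navier–Stokes
system on `ℝ³ × [0, T)`, Leray–Hopf from the rapidly decaying datum `u 0`, with no smooth
extension past `T`. Write `E(s) = ∫⁻ |∇u(s)|²`; a level `L > 0` DOMINATES at `t` if `E ≤ L` on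
`[0, t]`. Suppose that FOR THIS SOLUTION the four structural properties
(1) TYPE-II ENSTROPHY (`∀ C`, eventually `E > C ν^{3/2}/√(T−t)` somewhere on `[0, t]`),
(2) EVENTUALLY SLOW DOUBLING AT EVERY SCALE (`∀ K`, eventually every record doubling `L → 2L`
takes `≥ K ν³/L²`), (3) VANISHING AT THE CRITICAL SCALE (`∀ R ε`, eventually every ball of `R`
critical radii `ν²/L` carries `< εL` of `E(t)`), (4) FAINTNESS (`∀ θ`, eventually
`‖u(t, x)‖ < θ L/ν` for every `x` and every dominating level `L`) cannot hold together. Then the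
conclusion of the crux holds for this solution: there is a bounded ancient mild solution `v`
(`ν = 1`), smooth on `(−∞, 0) × ℝ³`, with `sup_{s<0} ∫|∇v(s)|² ≤ 1`, `L⁶` slices, and not
identically zero.

**Proof.** This is the body of the tree theorem `recordZoomAncient_of_noFaintBlowupKernel`
(`Theorems/GaldiLiouvilleGateRecordZoomAncientOfKernel.lean`, p158940), which takes the kernel
hypothesis universally closed in `(ν, T, u, p)` but USES it only at the fixed solution: Tao
representation (`stub_taoRep`), persistence constants (`stub_enstrophyPersistence`), Leray's
`L^∞` rate (`leray_blowup_rate_top_holds`, strip bound read off the representation), the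
universal velocity bound (`stub_zoomBound`), then the four-fold case split — Type-I enstrophy
along a sequence (`stub_typeIBranch`) / fast doubling at some scale (`stub_fastBranch`) /
enstrophy concentration at the critical scale (`stub_enstrophyConcentrationBranch`, with the
uniform `C^{1,κ}` bounds of `stub_zoomC1kappa stub_oseenC1kappa`) / frequent critical velocity
(`stub_velocityBranch`) / else the pointwise kernel hypothesis gives `False` — and the common
tail `recordZoomAncient_of_concentratedZooms`.
-/

noncomputable section

open Set MeasureTheory Filter Topology Function
open scoped ENNReal NNReal
open Literature.Analysis.FluidPDE

namespace Summit.NavierStokesRegularity.NavierStokesRegularity.Theorems.RecordZoomAncient.Birth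

-- the problem-side namespace `Summit.NavierStokesRegularity.NavierStokesRegularity.…` (summit =
-- problem for this single-problem summit) duplicates `NavierStokesRegularity` by design
set_option linter.dupNamespace false

/-- **Stub `stub_kernelAt` (r7, S1): the composition of the line, pointwise in the solution.**
For FIXED `ν, T > 0` and a classical solution `(u, p)` on `ℝ³ × [0, T)`, Leray–Hopf from the
rapidly decaying `u 0`, with no smooth extension past `T`: if the four structural properties
(1) Type-II enstrophy, (2) eventually slow doubling at every scale, (3) vanishing of the
enstrophy at the critical scale, (4) faintness cannot hold together FOR THIS SOLUTION, then this
solution generates a nontrivial bounded ancient mild solution `v` (`ν = 1`), smooth on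
`(−∞, 0) × ℝ³`, with enstrophy `≤ 1` and `L⁶` slices — the conclusion of the crux
`Theses.GaldiLiouvilleGate.RecordZoomAncient` for `(ν, T, u, p)`. This is the pointwise form of
the composition `recordZoomAncient_of_noFaintBlowupKernel` (p158940, kernel hypothesis
universally closed there); the proof is its body verbatim, the kernel being invoked at the fixed
solution only. -/
theorem stub_kernelAt :
    ∀ (ν T : ℝ), 0 < ν → 0 < T →
      ∀ (u : ℝ → EuclideanSpace ℝ (Fin 3) → EuclideanSpace ℝ (Fin 3)) (p : ℝ → EuclideanSpace ℝ (Fin 3) → ℝ),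
        IsClassicalNSSolutionOn (Set.Ico 0 T) ν 0 u p → IsLerayHopfOn T ν 0 (u 0) u →
        HasRapidSpatialDecay (u 0) → ¬ HasSmoothExtensionPast ν 0 u T →
        ((∀ C : ℝ, 0 < C → ∃ t' ∈ Set.Ico 0 T, ∀ t ∈ Set.Ico t' T, ∃ s ∈ Set.Icc 0 t,
            ENNReal.ofReal (C * (ν * Real.sqrt ν) / Real.sqrt (T - t)) <
              ∫⁻ x, ENNReal.ofReal (frobeniusNormSq (fderiv ℝ (u s) x))) →
          (∀ K : ℝ, 0 < K → ∃ t' ∈ Set.Ico 0 T, ∀ t₁ ∈ Set.Ico t' T, ∀ t₂ ∈ Set.Ioo t₁ T, ∀ L : ℝ, 0 < L →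
            (∀ s ∈ Set.Icc 0 t₂,
              (∫⁻ x, ENNReal.ofReal (frobeniusNormSq (fderiv ℝ (u s) x))) ≤ ENNReal.ofReal (2 * L)) →
            (∫⁻ x, ENNReal.ofReal (frobeniusNormSq (fderiv ℝ (u t₁) x))) ≤ ENNReal.ofReal L →
            ENNReal.ofReal (2 * L) ≤ (∫⁻ x, ENNReal.ofReal (frobeniusNormSq (fderiv ℝ (u t₂) x))) →
            K * ν ^ 3 / L ^ 2 ≤ t₂ - t₁) →
          (∀ R ε : ℝ, 0 < R → 0 < ε → ∃ t' ∈ Set.Ico 0 T, ∀ t ∈ Set.Ico t' T,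
            ∀ x : EuclideanSpace ℝ (Fin 3), ∀ L : ℝ, 0 < L →
            (∀ s ∈ Set.Icc 0 t,
              (∫⁻ x, ENNReal.ofReal (frobeniusNormSq (fderiv ℝ (u s) x))) ≤ ENNReal.ofReal L) →
            3 * ν ^ 3 / L ^ 2 ≤ t →
            (∫⁻ y in Metric.ball x (R * ν ^ 2 / L), ENNReal.ofReal (frobeniusNormSq (fderiv ℝ (u t) y))) <
              ENNReal.ofReal (ε * L)) →
          (∀ θ : ℝ, 0 < θ → ∃ t' ∈ Set.Ico 0 T, ∀ t ∈ Set.Ico t' T,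
            ∀ x : EuclideanSpace ℝ (Fin 3), ∀ L : ℝ, 0 < L →
            (∀ s ∈ Set.Icc 0 t,
              (∫⁻ x, ENNReal.ofReal (frobeniusNormSq (fderiv ℝ (u s) x))) ≤ ENNReal.ofReal L) →
            ‖u t x‖ < θ * L / ν) →
          False) →
        ∃ v : ℝ → EuclideanSpace ℝ (Fin 3) → EuclideanSpace ℝ (Fin 3),
          IsBoundedAncientMildSolution 1 v ∧
          ContDiffOn ℝ (⊤ : ℕ∞) (Function.uncurry v) (Set.Iio 0 ×ˢ Set.univ) ∧
          (∀ s < 0, ∫⁻ y, ENNReal.ofReal (frobeniusNormSq (fderiv ℝ (v s) y)) ≤ 1) ∧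
          (∀ s < 0, MemLp (v s) 6 volume) ∧ ¬ (∀ s < 0, ∀ y, v s y = 0) := by
  intro ν T hν hT u p hcl hLH hdec hnext hKernelAt
  -- (0) the representation: `u` is Tao-class on every `[0, T']`, `T' < T`
  have hrep : ∀ T' ∈ Set.Ioo 0 T, ∃ P : ℝ → EuclideanSpace ℝ (Fin 3) → ℝ, IsTaoSolutionOn T' ν (u 0) u P :=
    stub_taoRep ν T hν hT u p hcl hLH hdec
  -- (1) persistence constants
  obtain ⟨cP, K, hcP, hK, hpers⟩ := stub_enstrophyPersistence
  have hpers' := hpers ν T hν hT u p hcl hrep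
  -- Leray's `L^∞` blow-up rate (tree theorem), strip-boundedness from the representation
  obtain ⟨cL, hcL, hLer⟩ := leray_blowup_rate_top_holds
  have hstrip : ∀ T' ∈ Set.Ioo 0 T,
      eLpNorm (uncurry u) ∞ (volume.restrict (Set.Icc 0 T' ×ˢ univ)) < ∞ := by
    intro T' hT'
    obtain ⟨P, hP⟩ := hrep T' hT'
    obtain ⟨B, -, hB⟩ := hP.exists_bound_velocity
    rw [eLpNorm_exponent_top]
    refine eLpNormEssSup_lt_top_of_ae_bound (C := B) ?_
    filter_upwards [ae_restrict_mem (measurableSet_Icc.prod MeasurableSet.univ)] with w hw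
    obtain ⟨t, x⟩ := w
    exact hB t hw.1 x
  have hrate : ∀ t ∈ Set.Ico 0 T, ∃ x, cL / 2 * Real.sqrt ν / Real.sqrt (T - t) ≤ ‖u t x‖ := by
    intro t ht
    have h := hLer ν T hν hT u p ⟨hcl, hnext⟩ hLH hstrip t ht
    have ha : 0 < cL * Real.sqrt ν / Real.sqrt (T - t) := by
      have h1 : 0 < Real.sqrt ν := Real.sqrt_pos.2 hν
      have h2 : 0 < Real.sqrt (T - t) := Real.sqrt_pos.2 (sub_pos.2 ht.2)
      positivity
    obtain ⟨x, hx⟩ := exists_half_le_norm_of_ofReal_le_eLpNorm_top ha h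
    refine ⟨x, ?_⟩
    have heq : cL / 2 * Real.sqrt ν / Real.sqrt (T - t) = cL * Real.sqrt ν / Real.sqrt (T - t) / 2 := by ring
    rw [heq]
    exact hx
  -- the universal velocity bound of `stub_zoomBound` (its constant feeds the `C^{1,κ}` constants)
  obtain ⟨C, hC⟩ := stub_zoomBound
  -- (2) concentrated enstrophy-normalised zooms, by the case splits (Type-I enstrophy / fast doubling /
  -- enstrophy concentration / frequent critical velocity / the kernel)
  obtain ⟨tc, xc, L, s₀, θ, hs₀, hθ, htc, hL, hdom, hpast, hconc⟩ :
      ∃ (tc : ℕ → ℝ) (xc : ℕ → EuclideanSpace ℝ (Fin 3)) (L : ℕ → ℝ) (s₀ θ : ℝ),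
        s₀ < 0 ∧ 0 < θ ∧ (∀ n, 0 < tc n ∧ tc n < T) ∧ (∀ n, 0 < L n) ∧
        (∀ n, ∀ t ∈ Set.Icc 0 (tc n),
          ∫⁻ x, ENNReal.ofReal (frobeniusNormSq (fderiv ℝ (u t) x)) ≤ ENNReal.ofReal (L n)) ∧
        Tendsto (fun n => tc n * L n ^ 2) atTop atTop ∧
        (∀ n, θ ≤ ‖(ν / L n) • u (tc n + ν ^ 3 / L n ^ 2 * s₀) (xc n)‖) := by
    by_cases hI : ∃ C : ℝ, 0 < C ∧ ∀ t' ∈ Set.Ico 0 T, ∃ t ∈ Set.Ico t' T, ∀ s ∈ Set.Icc 0 t,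
        (∫⁻ x, ENNReal.ofReal (frobeniusNormSq (fderiv ℝ (u s) x))) ≤
          ENNReal.ofReal (C * (ν * Real.sqrt ν) / Real.sqrt (T - t))
    · obtain ⟨C, hC, hI⟩ := hI
      exact stub_typeIBranch ν T hν hT u p hcl (cL / 2) (by positivity) hrate cP K hcP hK hpers' C hC hI
    · push Not at hI
      by_cases hFD : ∃ K : ℝ, 0 < K ∧ ∀ t' ∈ Set.Ico 0 T, ∃ t₁ ∈ Set.Ico t' T, ∃ t₂ ∈ Set.Ioo t₁ T,
          ∃ L : ℝ, 0 < L ∧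
            (∀ s ∈ Set.Icc 0 t₂,
              (∫⁻ x, ENNReal.ofReal (frobeniusNormSq (fderiv ℝ (u s) x))) ≤ ENNReal.ofReal (2 * L)) ∧
            (∫⁻ x, ENNReal.ofReal (frobeniusNormSq (fderiv ℝ (u t₁) x))) ≤ ENNReal.ofReal L ∧
            ENNReal.ofReal (2 * L) ≤ (∫⁻ x, ENNReal.ofReal (frobeniusNormSq (fderiv ℝ (u t₂) x))) ∧
            t₂ - t₁ < K * ν ^ 3 / L ^ 2
      · obtain ⟨K₀, hK₀, hFD⟩ := hFD
        exact stub_fastBranch ν T hν hT u p hcl hLH hrep hnext cP K hcP hK hpers' K₀ hK₀ hFD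
      · push Not at hFD
        obtain ⟨C₁, H, κ, hκ, hC1k⟩ := stub_zoomC1kappa stub_oseenC1kappa C hC
        have hC1k' := hC1k ν T hν hT u p hcl hLH hdec hrep
        by_cases hEC : ∃ R ε : ℝ, 0 < R ∧ 0 < ε ∧ ∀ t' ∈ Set.Ico 0 T, ∃ t ∈ Set.Ico t' T,
            ∃ x : EuclideanSpace ℝ (Fin 3), ∃ L : ℝ, 0 < L ∧
              (∀ s ∈ Set.Icc 0 t,
                (∫⁻ x, ENNReal.ofReal (frobeniusNormSq (fderiv ℝ (u s) x))) ≤ ENNReal.ofReal L) ∧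
              3 * ν ^ 3 / L ^ 2 ≤ t ∧
              ENNReal.ofReal (ε * L) ≤
                ∫⁻ y in Metric.ball x (R * ν ^ 2 / L), ENNReal.ofReal (frobeniusNormSq (fderiv ℝ (u t) y))
        · obtain ⟨R, ε, hR, hε, hEC⟩ := hEC
          exact stub_enstrophyConcentrationBranch ν T hν hT u p hcl hLH hrep hnext cP K hcP hK hpers'
            C₁ H κ hκ hC1k' R ε hR hε hEC
        · push Not at hEC
          by_cases hV : ∃ θ : ℝ, 0 < θ ∧ ∀ t' ∈ Set.Ico 0 T, ∃ t ∈ Set.Ico t' T,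
              ∃ x : EuclideanSpace ℝ (Fin 3), ∃ L : ℝ, 0 < L ∧
                (∀ s ∈ Set.Icc 0 t,
                  (∫⁻ x, ENNReal.ofReal (frobeniusNormSq (fderiv ℝ (u s) x))) ≤ ENNReal.ofReal L) ∧
                θ * L / ν ≤ ‖u t x‖
          · obtain ⟨θ, hθ, hV⟩ := hV
            exact stub_velocityBranch ν T hν hT u p hcl hLH hrep hnext cP K hcP hK hpers' θ hθ hV
          · push Not at hV
            exact (hKernelAt hI hFD hEC hV).elim
  -- (3) the common tail
  exact recordZoomAncient_of_concentratedZooms ν T hν hT u p hcl hLH hdec tc xc L s₀ θ hs₀ hθ htc hL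
    hdom hpast hconc

end Summit.NavierStokesRegularity.NavierStokesRegularity.Theorems.RecordZoomAncient.Birth

end
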